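import Mathlib
import Summits.MatrixMultiplication.MatrixMultiplication.Theorems.SnSubsetDichotomyNoThresholdSubsetTriplePlancherelGrowthDefs
import Summits.MatrixMultiplication.MatrixMultiplication.Theorems.SnSubsetDichotomyNoThresholdSubsetTripleShapeBeforeDefs
import Summits.MatrixMultiplication.MatrixMultiplication.Theorems.SnSubsetDichotomyNoThresholdSubsetTriplePrefixBlock
import Summits.MatrixMultiplication.MatrixMultiplication.Theorems.SnSubsetDichotomyNoThresholdSubsetTripleTransProbRatio

/-!
# The Plancherel kernel as the conditional law of the next shape, counting form

Line `klr-graded-polynomial-method`, crux `SnSubsetDichotomy.NoThresholdSubsetTriple` (stmt-MatrixMultiplication-8302),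
stub `block_succ_card` (MODEL theorem, counting form).

For a same-shape pair `ω₀ = (λ₀, S₀, T₀) ∈ TableauPair n` and a time `t < n`, the PREFIX BLOCK of `ω₀` at time `t` is the
set of pairs `ω = (λ, S, T)` whose second tableau agrees with `T₀` on the entries `< t`
(`prefixKey n t ω = prefixKey n t ω₀`).  Let `Y = shapeBefore T₀ t` be the shape of the entries `< t` of `T₀` (a Young
diagram with `t` cells, `shapeBefore_api`).  For every addable node `z` of `Y`, the pairs of the block whose second
tableau puts the entry `t` at `z` number `p_z · #block`, `p_z = PlancherelStep.transProb Y z` the hook-product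
transition probability: under the uniform measure on `TableauPair n`, conditionally on the prefix filtration the next
shape `shapeBefore T (t+1) = Y ∪ {T t}` is distributed by the Plancherel kernel.

Proof.  The block is the block of the restriction `U ∈ SYT(Y)` of `T₀` to its first `t` entries, so
`t! · #block = n! · f^Y` (`prefix_block_card`); the sub-block at `z` is the block, at time `t + 1`, of the extension
`U_z ∈ SYT(Y ∪ z)` of `U` by `t ↦ z`, so `(t+1)! · #sub = n! · f^{Y ∪ z}`; and `p_z · (t+1) · f^Y = f^{Y ∪ z}`
(`transProb_mul_card_stdFilling`, the hook length formula).  Divide.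
-/

open MeasureTheory ProbabilityTheory
open scoped BigOperators ENNReal
open Literature.RepresentationTheory.FiniteGroups (addableNodes IsAddableNode TableauPair)
open Literature.NumberTheory.DiophantineGeometry (StdFilling)

namespace Summit.MatrixMultiplication.MatrixMultiplication.Theorems

open PlancherelStep PlancherelGrowth

/-! ### The prefix key and the prefix tableau -/

-- `Summit.<Summit>.<Problem>`: the two namespace components coincide for this single-conjunct summit.
set_option linter.dupNamespace false in
/-- Two pairs have the same prefix key at time `t` iff their second tableaux agree on the entries `< t`. -/
private theorem prefixKey_eq_iff {n t : ℕ} (ht : t ≤ n) (ω ω₀ : TableauPair n) :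
    prefixKey n t ω = prefixKey n t ω₀ ↔
      ∀ k : Fin t, (ω.2.2).1 ⟨k.1, lt_of_lt_of_le k.2 ht⟩ = (ω₀.2.2).1 ⟨k.1, lt_of_lt_of_le k.2 ht⟩ := by
  refine ⟨fun h k => ?_, fun h => funext fun k => ?_⟩
  · simpa [prefixKey, k.2] using congrFun h ⟨k.1, lt_of_lt_of_le k.2 ht⟩
  · simp only [prefixKey]
    split_ifs with hk
    · exact congrArg some (h ⟨k.1, hk⟩)
    · rfl

set_option linter.dupNamespace false in
/-- The restriction of a standard Young tableau `T` (filling all `n` cells of its shape) to its entries `< t` is a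
standard Young tableau `U` of the prefix shape `shapeBefore T t`, a Young diagram with `t` cells. -/
private theorem exists_prefixFilling {n : ℕ} {Y : YoungDiagram} (T : StdFilling n Y) (hY : Y.cells.card = n)
    {t : ℕ} (ht : t ≤ n) :
    ∃ (Yd : YoungDiagram) (U : StdFilling t Yd), Yd.cells = shapeBefore T.1 t ∧ Yd.cells.card = t ∧
      ∀ k : Fin t, U.1 k = T.1 ⟨k.1, lt_of_lt_of_le k.2 ht⟩ := by
  obtain ⟨-, -, hcard, hlow, -⟩ := shapeBefore_api n Y T hY
  refine ⟨⟨shapeBefore T.1 t, hlow t⟩, ⟨fun k => T.1 ⟨k.1, lt_of_lt_of_le k.2 ht⟩, fun k => ?_,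
    fun p q h => ?_, fun p q h => ?_⟩, rfl, hcard t ht, fun k => rfl⟩
  · refine (YoungDiagram.mem_cells _).1 (Finset.mem_image_of_mem _ (Finset.mem_filter.2 ⟨Finset.mem_univ _, ?_⟩))
    exact k.2
  · have h' : T.1 ⟨p.1, lt_of_lt_of_le p.2 ht⟩ = T.1 ⟨q.1, lt_of_lt_of_le q.2 ht⟩ := h
    exact Fin.ext (Fin.mk.inj_iff.1 (T.injective h'))
  · exact T.not_le (show (⟨p.1, lt_of_lt_of_le p.2 ht⟩ : Fin n) < ⟨q.1, lt_of_lt_of_le q.2 ht⟩ from h)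

/-! ### Adding the next cell (adapted from `…NoThresholdSubsetTriplePrefixBlock`, private there) -/

set_option linter.dupNamespace false in
/-- Adding an addable node to a lower set of cells gives again a lower set. -/
private theorem isLowerSet_insert_addable {ν : Finset (ℕ × ℕ)} (hν : IsLowerSet (ν : Set (ℕ × ℕ)))
    {z : ℕ × ℕ} (hz : IsAddableNode ν z) :
    IsLowerSet ((insert z ν : Finset (ℕ × ℕ)) : Set (ℕ × ℕ)) := by
  -- adapted from `SnSubsetDichotomyNoThresholdSubsetTriplePrefixBlock` (same namespace, private there)
  obtain ⟨r, c⟩ := z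
  obtain ⟨-, hup, hleft⟩ := hz
  dsimp only at hup hleft
  rintro ⟨a₁, a₂⟩ ⟨b₁, b₂⟩ hba ha
  obtain ⟨h₁, h₂⟩ := Prod.mk_le_mk.1 hba
  simp only [Finset.coe_insert, Set.mem_insert_iff, Finset.mem_coe, Prod.mk.injEq] at ha ⊢
  rcases ha with ⟨rfl, rfl⟩ | ha
  · by_cases hb : b₁ = a₁ ∧ b₂ = a₂
    · exact Or.inl hb
    · refine Or.inr ?_
      rcases Nat.lt_or_ge b₁ a₁ with hlt | hge
      · exact Finset.mem_coe.1 (hν (Prod.mk_le_mk.2 ⟨Nat.le_sub_one_of_lt hlt, h₂⟩)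
          (Finset.mem_coe.2 (hup.resolve_left (by omega))))
      · have hb₂ : b₂ < a₂ := by omega
        exact Finset.mem_coe.1 (hν (Prod.mk_le_mk.2 ⟨h₁, Nat.le_sub_one_of_lt hb₂⟩)
          (Finset.mem_coe.2 (hleft.resolve_left (by omega))))
  · exact Or.inr (Finset.mem_coe.1 (hν hba (Finset.mem_coe.2 ha)))

set_option linter.dupNamespace false in
/-- Extending `U ∈ SYT(Y)` by a new largest entry in a cell `y ∉ Y` gives a standard filling (`Fin.snoc U y`) of
any diagram with cells `Y ∪ {y}`. -/
private theorem exists_snocFilling {t : ℕ} {Y Y' : YoungDiagram} (U : StdFilling t Y) {y : ℕ × ℕ}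
    (hy : y ∉ Y.cells) (hY' : Y'.cells = insert y Y.cells) :
    ∃ U' : StdFilling (t + 1) Y', U'.1 = Fin.snoc U.1 y := by
  -- adapted from `SnSubsetDichotomyNoThresholdSubsetTriplePrefixBlock` (same namespace, private there)
  refine ⟨⟨Fin.snoc U.1 y, ?_⟩, rfl⟩
  have hmem : ∀ x, x ∈ Y' ↔ x = y ∨ x ∈ Y := fun x => by
    rw [← YoungDiagram.mem_cells, hY', Finset.mem_insert, YoungDiagram.mem_cells]
  have hne : ∀ p, U.1 p ≠ y := fun p h => hy ((YoungDiagram.mem_cells _).2 (h ▸ U.mem p))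
  refine ⟨fun p => ?_, fun p q h => ?_, fun p q h => ?_⟩
  · rcases Fin.eq_castSucc_or_eq_last p with ⟨p, rfl⟩ | rfl
    · rw [Fin.snoc_castSucc]; exact (hmem _).2 (Or.inr (U.mem p))
    · rw [Fin.snoc_last]; exact (hmem _).2 (Or.inl rfl)
  · rcases Fin.eq_castSucc_or_eq_last p with ⟨p, rfl⟩ | rfl <;>
      rcases Fin.eq_castSucc_or_eq_last q with ⟨q, rfl⟩ | rfl
    · rw [Fin.snoc_castSucc, Fin.snoc_castSucc] at h
      rw [U.injective h]
    · rw [Fin.snoc_castSucc, Fin.snoc_last] at h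
      exact absurd h (hne p)
    · rw [Fin.snoc_castSucc, Fin.snoc_last] at h
      exact absurd h.symm (hne q)
    · rfl
  · rcases Fin.eq_castSucc_or_eq_last p with ⟨p, rfl⟩ | rfl <;>
      rcases Fin.eq_castSucc_or_eq_last q with ⟨q, rfl⟩ | rfl
    · rw [Fin.snoc_castSucc, Fin.snoc_castSucc]
      exact U.not_le (Fin.castSucc_lt_castSucc_iff.1 h)
    · rw [Fin.snoc_castSucc, Fin.snoc_last]
      exact fun hle => hy (Y.isLowerSet hle (U.mem p))
    · exact absurd h (not_lt.2 (Fin.castSucc_lt_last q).le)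
    · exact absurd h (lt_irrefl _)

set_option linter.dupNamespace false in
/-- Prescribing the first `t + 1` cells of a growth sequence by `Fin.snoc g y` means prescribing the first
`t` cells by `g` and the cell of the entry `t` by `y`. -/
private theorem forall_snoc_iff {n t : ℕ} (ht : t ≤ n) (htn : t < n) (T : Fin n → ℕ × ℕ)
    (g : Fin t → ℕ × ℕ) (y : ℕ × ℕ) :
    ((∀ k : Fin t, T ⟨k.1, lt_of_lt_of_le k.2 ht⟩ = g k) ∧ T ⟨t, htn⟩ = y) ↔
      ∀ k : Fin (t + 1), T ⟨k.1, lt_of_lt_of_le k.2 htn⟩ = (Fin.snoc g y : Fin (t + 1) → ℕ × ℕ) k := by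
  -- adapted from `SnSubsetDichotomyNoThresholdSubsetTriplePrefixBlock` (same namespace, private there)
  constructor
  · rintro ⟨h₁, h₂⟩ k
    refine Fin.lastCases ?_ (fun i => ?_) k
    · rw [Fin.snoc_last]; exact h₂
    · rw [Fin.snoc_castSucc]; exact h₁ i
  · intro h
    refine ⟨fun k => ?_, ?_⟩
    · have := h (Fin.castSucc k); rwa [Fin.snoc_castSucc] at this
    · have := h (Fin.last t); rwa [Fin.snoc_last] at this

/-! ### The arithmetic of the two block counts and the hook ratio -/

set_option linter.dupNamespace false in
/-- From `t!·B = n!·f`, `(t+1)!·S = n!·f'` and `p·(t+1)·f = f'`: `S = p·B` (cancel `(t+1)! ≠ 0`). -/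
private theorem cast_eq_mul_of_blocks {n t B S f f' : ℕ} {p : ℝ}
    (hB : t.factorial * B = n.factorial * f) (hS : (t + 1).factorial * S = n.factorial * f')
    (hp : p * ((((t + 1 : ℕ) : ℝ)) * (f : ℝ)) = (f' : ℝ)) : (S : ℝ) = p * (B : ℝ) := by
  have hB' : (t.factorial : ℝ) * (B : ℝ) = (n.factorial : ℝ) * (f : ℝ) := by exact_mod_cast hB
  have hS' : ((t : ℝ) + 1) * (t.factorial : ℝ) * (S : ℝ) = (n.factorial : ℝ) * (f' : ℝ) := by
    rw [Nat.factorial_succ] at hS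
    exact_mod_cast hS
  push_cast at hp
  refine mul_left_cancel₀ (show ((t : ℝ) + 1) * (t.factorial : ℝ) ≠ 0 by positivity) ?_
  linear_combination hS' - ((t : ℝ) + 1) * p * hB' - (n.factorial : ℝ) * hp

/-! ### The theorem -/

set_option linter.dupNamespace false in
/-- **Model theorem, counting form: the Plancherel kernel is the conditional law of the next shape.**  For `t < n`,
a same-shape pair `ω₀ ∈ TableauPair n` with second tableau `T₀`, `Y = shapeBefore T₀ t` the shape of its entries
`< t`, and an addable node `z` of `Y`: among the pairs `ω = (λ, S, T)` whose second tableau agrees with `T₀` on the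
entries `< t` (the prefix block `prefixKey n t ω = prefixKey n t ω₀`), those with `T t = z` number
`transProb Y z · #block`.  (`t!·#block = n!·f^Y` and `(t+1)!·#sub = n!·f^{Y ∪ z}` by `prefix_block_card`, and
`p_z·(t+1)·f^Y = f^{Y∪z}` by the hook length formula, `transProb_mul_card_stdFilling`.) -/
theorem block_succ_card : ∀ (n t : ℕ) (ht : t < n) (ω₀ : TableauPair n) (z : ℕ × ℕ),
    z ∈ addableNodes (shapeBefore (ω₀.2.2).1 t) →
      (Nat.card {ω : TableauPair n // prefixKey n t ω = prefixKey n t ω₀ ∧ (ω.2.2).1 ⟨t, ht⟩ = z} : ℝ) =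
        transProb (shapeBefore (ω₀.2.2).1 t) z *
          (Nat.card {ω : TableauPair n // prefixKey n t ω = prefixKey n t ω₀} : ℝ) := by
  intro n t ht ω₀ z hz
  -- the prefix tableau `U ∈ SYT(Yd)`, `Yd.cells = shapeBefore T₀ t`, `|Yd| = t`
  obtain ⟨Yd, U, hYd, hcardY, hU⟩ := exists_prefixFilling ω₀.2.2 ω₀.1.card_cells_youngDiagram ht.le
  rw [← hYd] at hz ⊢
  have hz' : IsAddableNode Yd.cells z := Literature.RepresentationTheory.FiniteGroups.mem_addableNodes.1 hz
  -- the next shape `Yz = Yd ∪ z` and the extended tableau `U' = U, t ↦ z`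
  obtain ⟨Yz, hYz⟩ : ∃ Yz : YoungDiagram, Yz.cells = insert z Yd.cells :=
    ⟨⟨insert z Yd.cells, isLowerSet_insert_addable Yd.isLowerSet hz'⟩, rfl⟩
  have hcardYz : Yz.cells.card = t + 1 := by
    rw [hYz, Finset.card_insert_of_notMem hz'.1, hcardY]
  obtain ⟨U', hU'⟩ := exists_snocFilling U hz'.1 hYz
  -- the block is the block of `U`, the sub-block is the block of `U'`
  have eB : Nat.card {ω : TableauPair n // prefixKey n t ω = prefixKey n t ω₀} =
      Nat.card {ω : TableauPair n // ∀ k : Fin t, (ω.2.2).1 ⟨k.1, lt_of_lt_of_le k.2 ht.le⟩ = U.1 k} :=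
    Nat.card_congr (Equiv.subtypeEquivRight fun ω =>
      (prefixKey_eq_iff ht.le ω ω₀).trans (forall_congr' fun k => by rw [hU k]))
  have eS : Nat.card {ω : TableauPair n // prefixKey n t ω = prefixKey n t ω₀ ∧ (ω.2.2).1 ⟨t, ht⟩ = z} =
      Nat.card {ω : TableauPair n // ∀ k : Fin (t + 1), (ω.2.2).1 ⟨k.1, lt_of_lt_of_le k.2 ht⟩ = U'.1 k} :=
    Nat.card_congr (Equiv.subtypeEquivRight fun ω => by
      rw [hU']
      exact ((prefixKey_eq_iff ht.le ω ω₀).and Iff.rfl).trans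
        ((and_congr_left' (forall_congr' fun k => by rw [hU k])).trans
          (forall_snoc_iff ht.le ht (ω.2.2).1 U.1 z)))
  have hB : t.factorial * Nat.card {ω : TableauPair n // prefixKey n t ω = prefixKey n t ω₀} =
      n.factorial * Nat.card (StdFilling t Yd) := by
    rw [eB]
    exact prefix_block_card n t ht.le Yd hcardY U
  have hS : (t + 1).factorial *
      Nat.card {ω : TableauPair n // prefixKey n t ω = prefixKey n t ω₀ ∧ (ω.2.2).1 ⟨t, ht⟩ = z} =
        n.factorial * Nat.card (StdFilling (t + 1) Yz) := by
    rw [eS]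
    exact prefix_block_card n (t + 1) ht Yz hcardYz U'
  -- the hook ratio `p_z · (t+1) · f^{Yd} = f^{Yz}`
  have hp := transProb_mul_card_stdFilling Yd Yz z hz hYz
  rw [hcardY] at hp
  exact cast_eq_mul_of_blocks hB hS hp

end Summit.MatrixMultiplication.MatrixMultiplication.Theorems
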